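import Summits.MatrixMultiplication.MatrixMultiplication.Theorems.SoloBlindTriangleFibre

/-!
# The triangle move on Kraft masses (solo-blind s80)

K3.23.16 of the programme notes, move (3): in the triangle setting (zero-sum-free `S`, exponent 3,
`τ` H-good, `h` injective on `S`, triangle `a b c q1 q2 q3` of 3-term representations of `τ`)
and for any additive hom `π` killing `h q1, h q2, h q3`,
`E(τ; S) ≤ 3/8 + (1/4) · E_π(π τ; S \ hexad)`
(`soloBlind_mass_triangle_move`).  Ingredients: the fibre form of the member classification
(`soloBlind_triangle_fibre_shape`), and the VALUE LEMMA `soloBlind_triangle_value_le`: the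
admissible patterns realisable over one outside set `U` have total weight `≤ 2^{-|U|}/4`.  With
the quotient facts `soloBlind_triangle_quot_zsf` / `soloBlind_triangle_quot_hgood` this is the
complete TRIANGLE MOVE: Conjecture E for the quotient configuration (six elements down) gives
`E(τ;S) ≤ 1/2`.
-/

namespace Summit.MatrixMultiplication.MatrixMultiplication.Theorems

open Finset

universe u

variable {ι : Type*} [DecidableEq ι]
variable {G : Type u} [AddCommGroup G] [DecidableEq G]
variable {G' : Type*} [AddCommGroup G'] [DecidableEq G']

omit [DecidableEq G'] in
/-- THE VALUE LEMMA: for any `v`, the admissible non-triple patterns `Y` with `τ - h(Y) = v` have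
total weight `≤ 1/4` (two of weight `1/8` share the value `τ - ρ`; all other values are pairwise
separated by zero-sum freeness on `{q_i}`, `{q_i, q_j}`, injectivity and 3-torsion). -/
theorem soloBlind_triangle_value_le (three : ∀ g : G, g + g + g = 0) {x y z : G} (hx : x ≠ 0)
    (hy : y ≠ 0) (hz : z ≠ 0) (hxy : x + y ≠ 0) (hyz : y + z ≠ 0) (hxz : x + z ≠ 0) (ixy : x ≠ y)
    (iyz : y ≠ z) (ixz : x ≠ z) (τ v : G) {w : ℚ} (hw : 0 ≤ w) :
    (if v = τ - (x + y + z) then w / 8 else 0) + (if v = τ - (x + y + z) then w / 8 else 0) +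
    (if v = τ - (x + y) then w / 4 else 0) + (if v = τ - (y + z) then w / 4 else 0) +
    (if v = τ - (x + z) then w / 4 else 0) + (if v = τ - (x + y + z) - x then w / 16 else 0) +
    (if v = τ - (x + y + z) - y then w / 16 else 0) +
    (if v = τ - (x + y + z) - z then w / 16 else 0) ≤ w / 4 := by
  by_cases e1 : v = τ - (x + y + z)
  · have n2 : v ≠ τ - (x + y) := by
      rw [e1]; intro hh
      exact hz (soloBlind_tri_close_rel three τ x y z (0) (0) (0) (0) (sub_eq_zero.mpr hh) (-1)
        (by (try simp only [zero_smul, one_smul, neg_smul, add_zero, sub_zero]); abel))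
    have n3 : v ≠ τ - (y + z) := by
      rw [e1]; intro hh
      exact hx (soloBlind_tri_close_rel three τ x y z (0) (0) (0) (0) (sub_eq_zero.mpr hh) (-1)
        (by (try simp only [zero_smul, one_smul, neg_smul, add_zero, sub_zero]); abel))
    have n4 : v ≠ τ - (x + z) := by
      rw [e1]; intro hh
      exact hy (soloBlind_tri_close_rel three τ x y z (0) (0) (0) (0) (sub_eq_zero.mpr hh) (-1)
        (by (try simp only [zero_smul, one_smul, neg_smul, add_zero, sub_zero]); abel))
    have n5 : v ≠ τ - (x + y + z) - x := by
      rw [e1]; intro hh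
      exact hx (soloBlind_tri_close_rel three τ x y z (0) (0) (0) (0) (sub_eq_zero.mpr hh) (1)
        (by (try simp only [zero_smul, one_smul, add_zero, sub_zero]); abel))
    have n6 : v ≠ τ - (x + y + z) - y := by
      rw [e1]; intro hh
      exact hy (soloBlind_tri_close_rel three τ x y z (0) (0) (0) (0) (sub_eq_zero.mpr hh) (1)
        (by (try simp only [zero_smul, one_smul, add_zero, sub_zero]); abel))
    have n7 : v ≠ τ - (x + y + z) - z := by
      rw [e1]; intro hh
      exact hz (soloBlind_tri_close_rel three τ x y z (0) (0) (0) (0) (sub_eq_zero.mpr hh) (1)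
        (by (try simp only [zero_smul, one_smul, add_zero, sub_zero]); abel))
    rw [if_pos e1, if_neg n2, if_neg n3, if_neg n4, if_neg n5, if_neg n6, if_neg n7]; linarith
  by_cases e2 : v = τ - (x + y)
  · have n3 : v ≠ τ - (y + z) := by
      rw [e2]; intro hh
      exact ixz (soloBlind_tri_close_rel three τ x y z (0) (0) (0) (0) (sub_eq_zero.mpr hh) (-1)
        (by (try simp only [zero_smul, one_smul, neg_smul, add_zero]); abel))
    have n4 : v ≠ τ - (x + z) := by
      rw [e2]; intro hh
      exact iyz (soloBlind_tri_close_rel three τ x y z (0) (0) (0) (0) (sub_eq_zero.mpr hh) (-1)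
        (by (try simp only [zero_smul, one_smul, neg_smul, add_zero]); abel))
    have n5 : v ≠ τ - (x + y + z) - x := by
      rw [e2]; intro hh
      exact hxz (soloBlind_tri_close_rel three τ x y z (0) (0) (0) (0) (sub_eq_zero.mpr hh) (1)
        (by (try simp only [zero_smul, one_smul, add_zero, sub_zero]); abel))
    have n6 : v ≠ τ - (x + y + z) - y := by
      rw [e2]; intro hh
      exact hyz (soloBlind_tri_close_rel three τ x y z (0) (0) (0) (0) (sub_eq_zero.mpr hh) (1)
        (by (try simp only [zero_smul, one_smul, add_zero, sub_zero]); abel))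
    have n7 : v ≠ τ - (x + y + z) - z := by
      rw [e2]; intro hh
      exact hz (soloBlind_tri_close_rel three τ x y z (0) (0) (0) (1) (sub_eq_zero.mpr hh) (-1)
        (by (try simp only [zero_smul, one_smul, neg_smul, add_zero, zero_add, sub_zero]); abel))
    rw [if_neg e1, if_pos e2, if_neg n3, if_neg n4, if_neg n5, if_neg n6, if_neg n7]; linarith
  by_cases e3 : v = τ - (y + z)
  · have n4 : v ≠ τ - (x + z) := by
      rw [e3]; intro hh
      exact ixy (soloBlind_tri_close_rel three τ x y z (0) (0) (0) (0) (sub_eq_zero.mpr hh) (1)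
        (by (try simp only [zero_smul, one_smul, add_zero]); abel))
    have n5 : v ≠ τ - (x + y + z) - x := by
      rw [e3]; intro hh
      exact hx (soloBlind_tri_close_rel three τ x y z (0) (1) (0) (0) (sub_eq_zero.mpr hh) (-1)
        (by (try simp only [zero_smul, one_smul, neg_smul, add_zero, zero_add, sub_zero]); abel))
    have n6 : v ≠ τ - (x + y + z) - y := by
      rw [e3]; intro hh
      exact hxy (soloBlind_tri_close_rel three τ x y z (0) (0) (0) (0) (sub_eq_zero.mpr hh) (1)
        (by (try simp only [zero_smul, one_smul, add_zero, sub_zero]); abel))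
    have n7 : v ≠ τ - (x + y + z) - z := by
      rw [e3]; intro hh
      exact hxz (soloBlind_tri_close_rel three τ x y z (0) (0) (0) (0) (sub_eq_zero.mpr hh) (1)
        (by (try simp only [zero_smul, one_smul, add_zero, sub_zero]); abel))
    rw [if_neg e1, if_neg e2, if_pos e3, if_neg n4, if_neg n5, if_neg n6, if_neg n7]; linarith
  by_cases e4 : v = τ - (x + z)
  · have n5 : v ≠ τ - (x + y + z) - x := by
      rw [e4]; intro hh
      exact hxy (soloBlind_tri_close_rel three τ x y z (0) (0) (0) (0) (sub_eq_zero.mpr hh) (1)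
        (by (try simp only [zero_smul, one_smul, add_zero, sub_zero]); abel))
    have n6 : v ≠ τ - (x + y + z) - y := by
      rw [e4]; intro hh
      exact hy (soloBlind_tri_close_rel three τ x y z (0) (0) (1) (0) (sub_eq_zero.mpr hh) (-1)
        (by (try simp only [zero_smul, one_smul, neg_smul, add_zero, zero_add, sub_zero]); abel))
    have n7 : v ≠ τ - (x + y + z) - z := by
      rw [e4]; intro hh
      exact hyz (soloBlind_tri_close_rel three τ x y z (0) (0) (0) (0) (sub_eq_zero.mpr hh) (1)
        (by (try simp only [zero_smul, one_smul, add_zero, sub_zero]); abel))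
    rw [if_neg e1, if_neg e2, if_neg e3, if_pos e4, if_neg n5, if_neg n6, if_neg n7]; linarith
  by_cases e5 : v = τ - (x + y + z) - x
  · have n6 : v ≠ τ - (x + y + z) - y := by
      rw [e5]; intro hh
      exact ixy (soloBlind_tri_close_rel three τ x y z (0) (0) (0) (0) (sub_eq_zero.mpr hh) (-1)
        (by (try simp only [zero_smul, one_smul, neg_smul, add_zero]); abel))
    have n7 : v ≠ τ - (x + y + z) - z := by
      rw [e5]; intro hh
      exact ixz (soloBlind_tri_close_rel three τ x y z (0) (0) (0) (0) (sub_eq_zero.mpr hh) (-1)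
        (by (try simp only [zero_smul, one_smul, neg_smul, add_zero]); abel))
    rw [if_neg e1, if_neg e2, if_neg e3, if_neg e4, if_pos e5, if_neg n6, if_neg n7]; linarith
  by_cases e6 : v = τ - (x + y + z) - y
  · have n7 : v ≠ τ - (x + y + z) - z := by
      rw [e6]; intro hh
      exact iyz (soloBlind_tri_close_rel three τ x y z (0) (0) (0) (0) (sub_eq_zero.mpr hh) (-1)
        (by (try simp only [zero_smul, one_smul, neg_smul, add_zero]); abel))
    rw [if_neg e1, if_neg e2, if_neg e3, if_neg e4, if_neg e5, if_pos e6, if_neg n7]; linarith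
  by_cases e7 : v = τ - (x + y + z) - z
  · rw [if_neg e1, if_neg e2, if_neg e3, if_neg e4, if_neg e5, if_neg e6, if_pos e7]; linarith
  rw [if_neg e1, if_neg e2, if_neg e3, if_neg e4, if_neg e5, if_neg e6, if_neg e7]; linarith

omit [DecidableEq G] [DecidableEq G'] in
/-- `∑` over `insert` is at most the inserted value plus the rest (nonnegative summands). -/
theorem soloBlind_sum_insert_le {α : Type*} [DecidableEq α] (g : α → ℚ) (hg : ∀ x, 0 ≤ g x)
    (x : α) (s : Finset α) : ∑ y ∈ insert x s, g y ≤ g x + ∑ y ∈ s, g y := by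
  by_cases hx : x ∈ s
  · rw [Finset.insert_eq_of_mem hx]; linarith [hg x]
  · rw [Finset.sum_insert hx]

set_option maxHeartbeats 1600000 in
/-- THE TRIANGLE MOVE ON MASSES (K3.23.16 (3)): `E(τ; S) ≤ 3/8 + E_π(π τ; S \ hexad)/4` for every
additive hom `π` killing the three meeting values. -/
theorem soloBlind_mass_triangle_move (three : ∀ g : G, g + g + g = 0) {h : ι → G}
    {S : Finset ι} (zsf : ∀ T ⊆ S, T.Nonempty → ∑ i ∈ T, h i ≠ 0) {τ : G}
    (hgood : ∀ T ⊆ S, ∑ i ∈ T, h i ≠ τ + τ) (hinj : ∀ x ∈ S, ∀ y ∈ S, h x = h y → x = y)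
    {a b c q1 q2 q3 : ι} (ha : a ∈ S) (hb : b ∈ S) (hc : c ∈ S) (hq1 : q1 ∈ S) (hq2 : q2 ∈ S)
    (hq3 : q3 ∈ S) (d_a_b : a ≠ b) (d_a_c : a ≠ c) (d_a_q1 : a ≠ q1) (d_a_q2 : a ≠ q2)
    (d_a_q3 : a ≠ q3) (d_b_c : b ≠ c) (d_b_q1 : b ≠ q1) (d_b_q2 : b ≠ q2) (d_b_q3 : b ≠ q3)
    (d_c_q1 : c ≠ q1) (d_c_q2 : c ≠ q2) (d_c_q3 : c ≠ q3) (d_q1_q2 : q1 ≠ q2) (d_q1_q3 : q1 ≠ q3)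
    (d_q2_q3 : q2 ≠ q3)
    (hA : h a + h q1 + h q3 = τ) (hB : h b + h q1 + h q2 = τ) (hC : h c + h q2 + h q3 = τ)
    (π : G →+ G') (hπ1 : π (h q1) = 0) (hπ2 : π (h q2) = 0) (hπ3 : π (h q3) = 0) :
    soloBlindMass h S τ ≤ 3 / 8 + (1 / 4) *
      soloBlindMass (fun i => π (h i)) (S \ soloBlindHexad a b c q1 q2 q3) (π τ) := by
  have single : ∀ p ∈ S, h p ≠ 0 := fun p hp => by
    have := zsf {p} (Finset.singleton_subset_iff.mpr hp) (Finset.singleton_nonempty p)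
    rwa [Finset.sum_singleton] at this
  have pair : ∀ p ∈ S, ∀ p' ∈ S, p ≠ p' → h p + h p' ≠ 0 := fun p hp p' hp' hpp' => by
    have := zsf {p, p'} (Finset.insert_subset_iff.mpr ⟨hp, Finset.singleton_subset_iff.mpr hp'⟩)
      (Finset.insert_nonempty _ _)
    rwa [Finset.sum_pair hpp'] at this
  have i12 : h q1 ≠ h q2 := fun e => d_q1_q2 (hinj _ hq1 _ hq2 e)
  have i23 : h q2 ≠ h q3 := fun e => d_q2_q3 (hinj _ hq2 _ hq3 e)
  have i13 : h q1 ≠ h q3 := fun e => d_q1_q3 (hinj _ hq1 _ hq3 e)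
  have hout : ∀ z ∈ soloBlindHexad a b c q1 q2 q3, ∀ M : Finset ι,
      z ∉ M \ soloBlindHexad a b c q1 q2 q3 := fun z hz M hzU => (Finset.mem_sdiff.mp hzU).2 hz
  have hXsub : ∀ Y : Finset ι, Y ⊆ soloBlindHexad a b c q1 q2 q3 → ∀ M : Finset ι,
      Disjoint (M \ soloBlindHexad a b c q1 q2 q3) Y := fun Y hY M =>
    Finset.disjoint_left.mpr fun i hiU hiY => hout i (hY hiY) M hiU
  set F := soloBlindSeqRepAll h S τ with hF
  set F' := soloBlindSeqRepAll (fun i => π (h i)) (S \ soloBlindHexad a b c q1 q2 q3) (π τ) with hF'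
  set f : Finset ι → Finset ι := fun M => M \ soloBlindHexad a b c q1 q2 q3 with hf
  have hmaps : ∀ M ∈ F, f M ∈ F.image f := fun M hM => Finset.mem_image_of_mem f hM
  -- the fibre bound
  have hfib : ∀ U ∈ F.image f, ∑ M ∈ F with f M = U, (1 / 2 : ℚ) ^ M.card ≤
      (if U = ∅ then 3 / 8 else 0) + (1 / 4) * (if U ∈ F' then (1 / 2 : ℚ) ^ U.card else 0) := by
    intro U hUT
    obtain ⟨M₀, hM₀F, hM₀U⟩ := Finset.mem_image.mp hUT
    obtain ⟨hM₀S, hM₀sum⟩ := soloBlind_mem_seqRepAll.mp hM₀F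
    have hUS' : U ⊆ S \ soloBlindHexad a b c q1 q2 q3 := by
      rw [← hM₀U]; exact Finset.sdiff_subset_sdiff hM₀S (subset_refl _)
    have memfib : ∀ M ∈ F.filter (fun M => f M = U), M ⊆ S ∧ ∑ i ∈ M, h i = τ ∧
        M \ soloBlindHexad a b c q1 q2 q3 = U := by
      intro M hM
      obtain ⟨hMF, hMU⟩ := Finset.mem_filter.mp hM
      exact ⟨(soloBlind_mem_seqRepAll.mp hMF).1, (soloBlind_mem_seqRepAll.mp hMF).2, hMU⟩
    by_cases hU0 : U = ∅
    · -- the fibre of `∅` is `{A, B, C}`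
      rw [if_pos hU0]
      have hsub : F.filter (fun M => f M = U) ⊆ {{a, q1, q3}, {b, q1, q2}, {c, q2, q3}} := by
        intro M hM
        obtain ⟨hMS, hMsum, hMU⟩ := memfib M hM
        rcases soloBlind_triangle_fibre_shape three zsf hgood ha hb hc hq1 hq2 hq3 d_a_b d_a_c
          d_a_q1 d_a_q2 d_a_q3 d_b_c d_b_q1 d_b_q2 d_b_q3 d_c_q1 d_c_q2 d_c_q3 d_q1_q2 d_q1_q3
          d_q2_q3 hA hB hC hMS hMsum hMU with ⟨-, e | e | e⟩ | ⟨hne, -⟩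
        · rw [e]; simp
        · rw [e]; simp
        · rw [e]; simp
        · exact absurd hU0 hne.ne_empty
      have w3 : ∀ x y z : ι, x ≠ y → x ≠ z → y ≠ z →
          (1 / 2 : ℚ) ^ ({x, y, z} : Finset ι).card = 1 / 8 := by
        intro x y z hxy hxz hyz
        rw [Finset.card_eq_three.mpr ⟨x, y, z, hxy, hxz, hyz, rfl⟩]; norm_num
      have hnn : ∀ M : Finset ι, 0 ≤ (1 / 2 : ℚ) ^ M.card := fun M => by positivity
      calc ∑ M ∈ F with f M = U, (1 / 2 : ℚ) ^ M.card
          ≤ ∑ M ∈ ({{a, q1, q3}, {b, q1, q2}, {c, q2, q3}} : Finset (Finset ι)),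
              (1 / 2 : ℚ) ^ M.card :=
            Finset.sum_le_sum_of_subset_of_nonneg hsub (fun M _ _ => hnn M)
        _ ≤ (1 / 2 : ℚ) ^ ({a, q1, q3} : Finset ι).card +
              ((1 / 2 : ℚ) ^ ({b, q1, q2} : Finset ι).card +
                ∑ M ∈ ({{c, q2, q3}} : Finset (Finset ι)), (1 / 2 : ℚ) ^ M.card) := by
            have h1 := soloBlind_sum_insert_le (fun M : Finset ι => (1 / 2 : ℚ) ^ M.card) hnn
              {a, q1, q3} ({{b, q1, q2}, {c, q2, q3}} : Finset (Finset ι))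
            have h2 := soloBlind_sum_insert_le (fun M : Finset ι => (1 / 2 : ℚ) ^ M.card) hnn
              {b, q1, q2} ({{c, q2, q3}} : Finset (Finset ι))
            linarith
        _ = 3 / 8 := by
            rw [Finset.sum_singleton, w3 a q1 q3 d_a_q1 d_a_q3 d_q1_q3,
              w3 b q1 q2 d_b_q1 d_b_q2 d_q1_q2, w3 c q2 q3 d_c_q2 d_c_q3 d_q2_q3]; norm_num
        _ ≤ 3 / 8 + 1 / 4 * (if U ∈ F' then (1 / 2 : ℚ) ^ U.card else 0) := by
            have : (0 : ℚ) ≤ (if U ∈ F' then (1 / 2 : ℚ) ^ U.card else 0) := by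
              split_ifs <;> positivity
            linarith
    · -- a nonempty outside set `U`
      rw [if_neg hU0, zero_add]
      set s := ∑ i ∈ U, h i with hs
      -- `U` represents `π τ` in the quotient
      have hUF' : U ∈ F' := by
        refine soloBlind_mem_seqRepAll.mpr ⟨hUS', ?_⟩
        rw [← map_sum]
        rcases soloBlind_triangle_fibre_shape three zsf hgood ha hb hc hq1 hq2 hq3 d_a_b d_a_c
          d_a_q1 d_a_q2 d_a_q3 d_b_c d_b_q1 d_b_q2 d_b_q3 d_c_q1 d_c_q2 d_c_q3 d_q1_q2 d_q1_q3
          d_q2_q3 hA hB hC hM₀S hM₀sum hM₀U with ⟨h0, -⟩ | ⟨-, hcase⟩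
        · exact absurd h0 hU0
        · rcases hcase with ⟨-, e⟩ | ⟨-, e⟩ | ⟨-, e⟩ | ⟨-, e⟩ | ⟨-, e⟩ | ⟨-, e⟩ | ⟨-, e⟩ |
            ⟨-, e⟩ <;> simp [e, hπ1, hπ2, hπ3]
      rw [if_pos hUF']
      have wY : ∀ Y : Finset ι, Y ⊆ soloBlindHexad a b c q1 q2 q3 →
          (1 / 2 : ℚ) ^ (U ∪ Y).card = (1 / 2 : ℚ) ^ U.card * (1 / 2 : ℚ) ^ Y.card := by
        intro Y hY
        rw [Finset.card_union_of_disjoint (by rw [← hM₀U]; exact hXsub Y hY M₀), pow_add]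
      have subY : ∀ Y : Finset ι, (∀ z ∈ Y, z = a ∨ z = b ∨ z = c ∨ z = q1 ∨ z = q2 ∨ z = q3) →
          Y ⊆ soloBlindHexad a b c q1 q2 q3 := fun Y hY z hz => by
        simp only [soloBlindHexad, Finset.mem_insert, Finset.mem_singleton]; exact hY z hz
      have sP : ({a, b, c} : Finset ι) ⊆ soloBlindHexad a b c q1 q2 q3 :=
        subY _ (by intro z hz; simp only [Finset.mem_insert, Finset.mem_singleton] at hz; tauto)
      have sQ : ({q1, q2, q3} : Finset ι) ⊆ soloBlindHexad a b c q1 q2 q3 :=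
        subY _ (by intro z hz; simp only [Finset.mem_insert, Finset.mem_singleton] at hz; tauto)
      have s12 : ({q1, q2} : Finset ι) ⊆ soloBlindHexad a b c q1 q2 q3 :=
        subY _ (by intro z hz; simp only [Finset.mem_insert, Finset.mem_singleton] at hz; tauto)
      have s23 : ({q2, q3} : Finset ι) ⊆ soloBlindHexad a b c q1 q2 q3 :=
        subY _ (by intro z hz; simp only [Finset.mem_insert, Finset.mem_singleton] at hz; tauto)
      have s13 : ({q1, q3} : Finset ι) ⊆ soloBlindHexad a b c q1 q2 q3 :=
        subY _ (by intro z hz; simp only [Finset.mem_insert, Finset.mem_singleton] at hz; tauto)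
      have sP1 : ({a, b, c, q1} : Finset ι) ⊆ soloBlindHexad a b c q1 q2 q3 :=
        subY _ (by intro z hz; simp only [Finset.mem_insert, Finset.mem_singleton] at hz; tauto)
      have sP2 : ({a, b, c, q2} : Finset ι) ⊆ soloBlindHexad a b c q1 q2 q3 :=
        subY _ (by intro z hz; simp only [Finset.mem_insert, Finset.mem_singleton] at hz; tauto)
      have sP3 : ({a, b, c, q3} : Finset ι) ⊆ soloBlindHexad a b c q1 q2 q3 :=
        subY _ (by intro z hz; simp only [Finset.mem_insert, Finset.mem_singleton] at hz; tauto)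
      have cP : ({a, b, c} : Finset ι).card = 3 :=
        Finset.card_eq_three.mpr ⟨a, b, c, d_a_b, d_a_c, d_b_c, rfl⟩
      have cQ : ({q1, q2, q3} : Finset ι).card = 3 :=
        Finset.card_eq_three.mpr ⟨q1, q2, q3, d_q1_q2, d_q1_q3, d_q2_q3, rfl⟩
      have c12 : ({q1, q2} : Finset ι).card = 2 := Finset.card_pair d_q1_q2
      have c23 : ({q2, q3} : Finset ι).card = 2 := Finset.card_pair d_q2_q3
      have c13 : ({q1, q3} : Finset ι).card = 2 := Finset.card_pair d_q1_q3
      have c4 : ∀ q : ι, a ≠ q → b ≠ q → c ≠ q → ({a, b, c, q} : Finset ι).card = 4 := by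
        intro q haq hbq hcq
        have e : ({a, b, c, q} : Finset ι) = insert a {b, c, q} := rfl
        have hn : a ∉ ({b, c, q} : Finset ι) := by
          simp only [Finset.mem_insert, Finset.mem_singleton, not_or]; exact ⟨d_a_b, d_a_c, haq⟩
        rw [e, Finset.card_insert_of_notMem hn,
          Finset.card_eq_three.mpr ⟨b, c, q, d_b_c, hbq, hcq, rfl⟩]
      set w : ℚ := (1 / 2 : ℚ) ^ U.card with hw
      have hw0 : 0 ≤ w := by positivity
      let t : Finset ι → G → ℚ → Finset ι → ℚ := fun Y v r M => if M = U ∪ Y ∧ s = v then r else 0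
      have ht0 : ∀ Y v r, 0 ≤ r → ∀ M, 0 ≤ t Y v r M := by
        intro Y v r hr M; simp only [t]; split_ifs <;> linarith
      have htsum : ∀ Y v r, 0 ≤ r → ∑ M ∈ F with f M = U, t Y v r M ≤ if s = v then r else 0 := by
        intro Y v r hr
        by_cases hv : s = v
        · rw [if_pos hv]
          have : ∀ M, t Y v r M = if M = U ∪ Y then r else 0 := by
            intro M; simp only [t, hv, and_true]
          simp_rw [this]
          rw [Finset.sum_ite_eq']
          split_ifs <;> linarith
        · rw [if_neg hv]
          have : ∀ M, t Y v r M = 0 := by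
            intro M; simp only [t, hv, and_false, if_false]
          simp_rw [this]; rw [Finset.sum_const_zero]
      -- every member is dominated by the sum of the eight terms
      have hdom : ∀ M ∈ F.filter (fun M => f M = U), (1 / 2 : ℚ) ^ M.card ≤
          t {a, b, c} (τ - (h q1 + h q2 + h q3)) (w / 8) M +
          t {q1, q2, q3} (τ - (h q1 + h q2 + h q3)) (w / 8) M +
          t {q1, q2} (τ - (h q1 + h q2)) (w / 4) M + t {q2, q3} (τ - (h q2 + h q3)) (w / 4) M +
          t {q1, q3} (τ - (h q1 + h q3)) (w / 4) M +
          t {a, b, c, q1} (τ - (h q1 + h q2 + h q3) - h q1) (w / 16) M +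
          t {a, b, c, q2} (τ - (h q1 + h q2 + h q3) - h q2) (w / 16) M +
          t {a, b, c, q3} (τ - (h q1 + h q2 + h q3) - h q3) (w / 16) M := by
        intro M hM
        obtain ⟨hMS, hMsum, hMU⟩ := memfib M hM
        have n1 := ht0 {a, b, c} (τ - (h q1 + h q2 + h q3)) (w / 8) (by positivity) M
        have n2 := ht0 {q1, q2, q3} (τ - (h q1 + h q2 + h q3)) (w / 8) (by positivity) M
        have n3 := ht0 {q1, q2} (τ - (h q1 + h q2)) (w / 4) (by positivity) M
        have n4 := ht0 {q2, q3} (τ - (h q2 + h q3)) (w / 4) (by positivity) M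
        have n5 := ht0 {q1, q3} (τ - (h q1 + h q3)) (w / 4) (by positivity) M
        have n6 := ht0 {a, b, c, q1} (τ - (h q1 + h q2 + h q3) - h q1) (w / 16) (by positivity) M
        have n7 := ht0 {a, b, c, q2} (τ - (h q1 + h q2 + h q3) - h q2) (w / 16) (by positivity) M
        have n8 := ht0 {a, b, c, q3} (τ - (h q1 + h q2 + h q3) - h q3) (w / 16) (by positivity) M
        have key : ∀ (Y : Finset ι) (v : G) (r : ℚ), Y ⊆ soloBlindHexad a b c q1 q2 q3 →
            (1 / 2 : ℚ) ^ U.card * (1 / 2 : ℚ) ^ Y.card = r → M = U ∪ Y → s = v →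
            (1 / 2 : ℚ) ^ M.card = t Y v r M := by
          intro Y v r hY hr eM ev
          have : t Y v r M = r := by simp only [t, eM, ev, and_self, if_true]
          rw [this, eM, wY Y hY, hr]
        rcases soloBlind_triangle_fibre_shape three zsf hgood ha hb hc hq1 hq2 hq3 d_a_b d_a_c
          d_a_q1 d_a_q2 d_a_q3 d_b_c d_b_q1 d_b_q2 d_b_q3 d_c_q1 d_c_q2 d_c_q3 d_q1_q2 d_q1_q3
          d_q2_q3 hA hB hC hMS hMsum hMU with ⟨h0, -⟩ | ⟨-, hcase⟩
        · exact absurd h0 hU0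
        rcases hcase with ⟨e, ev⟩ | ⟨e, ev⟩ | ⟨e, ev⟩ | ⟨e, ev⟩ | ⟨e, ev⟩ | ⟨e, ev⟩ | ⟨e, ev⟩ |
          ⟨e, ev⟩
        · rw [key _ _ (w / 8) sP (by rw [hw, cP]; ring) e ev]; linarith
        · rw [key _ _ (w / 8) sQ (by rw [hw, cQ]; ring) e ev]; linarith
        · rw [key _ _ (w / 4) s12 (by rw [hw, c12]; ring) e ev]; linarith
        · rw [key _ _ (w / 4) s23 (by rw [hw, c23]; ring) e ev]; linarith
        · rw [key _ _ (w / 4) s13 (by rw [hw, c13]; ring) e ev]; linarith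
        · rw [key _ _ (w / 16) sP1 (by rw [hw, c4 q1 d_a_q1 d_b_q1 d_c_q1]; ring) e ev]
          linarith
        · rw [key _ _ (w / 16) sP2 (by rw [hw, c4 q2 d_a_q2 d_b_q2 d_c_q2]; ring) e ev]
          linarith
        · rw [key _ _ (w / 16) sP3 (by rw [hw, c4 q3 d_a_q3 d_b_q3 d_c_q3]; ring) e ev]
          linarith
      -- sum over the fibre, exchange, and apply the value lemma
      have val := soloBlind_triangle_value_le three (single q1 hq1) (single q2 hq2) (single q3 hq3)
        (pair q1 hq1 q2 hq2 d_q1_q2) (pair q2 hq2 q3 hq3 d_q2_q3) (pair q1 hq1 q3 hq3 d_q1_q3)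
        i12 i23 i13 τ s hw0
      calc ∑ M ∈ F with f M = U, (1 / 2 : ℚ) ^ M.card
          ≤ ∑ M ∈ F with f M = U,
              (t {a, b, c} (τ - (h q1 + h q2 + h q3)) (w / 8) M +
              t {q1, q2, q3} (τ - (h q1 + h q2 + h q3)) (w / 8) M +
              t {q1, q2} (τ - (h q1 + h q2)) (w / 4) M + t {q2, q3} (τ - (h q2 + h q3)) (w / 4) M +
              t {q1, q3} (τ - (h q1 + h q3)) (w / 4) M +
              t {a, b, c, q1} (τ - (h q1 + h q2 + h q3) - h q1) (w / 16) M +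
              t {a, b, c, q2} (τ - (h q1 + h q2 + h q3) - h q2) (w / 16) M +
              t {a, b, c, q3} (τ - (h q1 + h q2 + h q3) - h q3) (w / 16) M) :=
            Finset.sum_le_sum hdom
        _ ≤ (if s = τ - (h q1 + h q2 + h q3) then w / 8 else 0) +
            (if s = τ - (h q1 + h q2 + h q3) then w / 8 else 0) +
            (if s = τ - (h q1 + h q2) then w / 4 else 0) +
            (if s = τ - (h q2 + h q3) then w / 4 else 0) +
            (if s = τ - (h q1 + h q3) then w / 4 else 0) +
            (if s = τ - (h q1 + h q2 + h q3) - h q1 then w / 16 else 0) +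
            (if s = τ - (h q1 + h q2 + h q3) - h q2 then w / 16 else 0) +
            (if s = τ - (h q1 + h q2 + h q3) - h q3 then w / 16 else 0) := by
            simp only [Finset.sum_add_distrib]
            have p8 : (0 : ℚ) ≤ w / 8 := by positivity
            have p4 : (0 : ℚ) ≤ w / 4 := by positivity
            have p16 : (0 : ℚ) ≤ w / 16 := by positivity
            linarith [htsum {a, b, c} (τ - (h q1 + h q2 + h q3)) (w / 8) p8,
              htsum {q1, q2, q3} (τ - (h q1 + h q2 + h q3)) (w / 8) p8,
              htsum {q1, q2} (τ - (h q1 + h q2)) (w / 4) p4,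
              htsum {q2, q3} (τ - (h q2 + h q3)) (w / 4) p4,
              htsum {q1, q3} (τ - (h q1 + h q3)) (w / 4) p4,
              htsum {a, b, c, q1} (τ - (h q1 + h q2 + h q3) - h q1) (w / 16) p16,
              htsum {a, b, c, q2} (τ - (h q1 + h q2 + h q3) - h q2) (w / 16) p16,
              htsum {a, b, c, q3} (τ - (h q1 + h q2 + h q3) - h q3) (w / 16) p16]
        _ ≤ w / 4 := val
        _ = 1 / 4 * (1 / 2 : ℚ) ^ U.card := by rw [hw]; ring
  have hempty : ∑ U ∈ F.image f, (if U = ∅ then (3 / 8 : ℚ) else 0) ≤ 3 / 8 := by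
    rw [Finset.sum_ite_eq']; split_ifs <;> norm_num
  have hF'le : ∑ U ∈ F.image f, (if U ∈ F' then (1 / 2 : ℚ) ^ U.card else 0) ≤
      soloBlindMass (fun i => π (h i)) (S \ soloBlindHexad a b c q1 q2 q3) (π τ) := by
    rw [soloBlindMass, ← hF', ← Finset.sum_filter]
    exact Finset.sum_le_sum_of_subset_of_nonneg (fun U hU => (Finset.mem_filter.mp hU).2)
      (fun _ _ _ => by positivity)
  rw [soloBlindMass, ← hF, ← Finset.sum_fiberwise_of_maps_to hmaps]
  calc ∑ U ∈ F.image f, ∑ M ∈ F with f M = U, (1 / 2 : ℚ) ^ M.card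
      ≤ ∑ U ∈ F.image f,
          ((if U = ∅ then (3 / 8 : ℚ) else 0) +
            (1 / 4) * (if U ∈ F' then (1 / 2 : ℚ) ^ U.card else 0)) := Finset.sum_le_sum hfib
    _ = ∑ U ∈ F.image f, (if U = ∅ then (3 / 8 : ℚ) else 0) +
          (1 / 4) * ∑ U ∈ F.image f, (if U ∈ F' then (1 / 2 : ℚ) ^ U.card else 0) := by
        rw [Finset.sum_add_distrib, Finset.mul_sum]
    _ ≤ 3 / 8 + (1 / 4) *
          soloBlindMass (fun i => π (h i)) (S \ soloBlindHexad a b c q1 q2 q3) (π τ) :=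
        add_le_add hempty (mul_le_mul_of_nonneg_left hF'le (by norm_num))

end Summit.MatrixMultiplication.MatrixMultiplication.Theorems
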